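import Literature.NumberTheory.LFunctions.Zhang2022.RepairCrossSlotForm
import Literature.NumberTheory.LFunctions.Zhang2022.RepairPairFormGram
import Literature.NumberTheory.LFunctions.Zhang2022.RepairGluedForm

/-!
# Zhang (2022), repair rung F-S1R, K-S2 (second half): the `𝔠₃` slot of record
# `frakc3S θ = P(g₁, R̃g₂)`, the glued design profile, `C232S θ = 𝔅(𝔤_θ)`, and the discrepancy
# to the transcribed readings as an explicit window form

Y. Zhang, *Discrete mean estimates and the Landau–Siegel zero*, arXiv:2211.02515v1 (2022)
[Zhang2022LandauSiegel] — an unrefereed manuscript under adjudication; nothing here is a claim about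
its Theorems 1–2. Cell ruling R3 (D2a): the class functional OF RECORD for the cross term
`Ξ₁₃ = 𝔠₃𝔞𝔓` ((18.1); `Ξ₁ = Ξ₁₁ + Ξ₁₂ + 2Re Ξ₁₃`, (8.2)) is the EXACT bilinear main term — the polar
value `P(g₁, R̃g₂)` (`MainTermFormCauchySchwarz.mainTermFormPolar`) on the `H₁`-profile
`g₁ = ϰ(ν₁,k₁) + ι₂ϰ(ν₂,k₂)` (`RepairPairFormGram.h1Profile`) and the functional-equation reflection
(`RepairFormReflection.reflProfile`) of the `H₂`-profile `g₂ = ῑ₄ϰ(ν₂,k₂) + ῑ₃ϰ(ν₃,k₃)`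
(`h2Profile`); audit dictionary `pub-zhang/STRUCTURE.md` §§3–4, derivation map
`repair/theory/KS2-DERIVATION.md` §D.

* `gluedS θ = h1Profile + R̃ h2Profile`, **`frakc3S θ := P(h1Profile, R̃ h2Profile)`**,
  **`C232S θ := 𝔅(gluedS θ)`** (`C232S_eq_form` = the `h232` hypothesis of
  `RepairStructuralBarrier.not_repairable_true_need_of_dictionary`, by `rfl`; `gluedS_isH1` = its `hgl`);
* on `AdmissibleTheta θ`: `C232S_eq_blocks` (`= 𝔅(g₁) + 𝔅(g₂) + 2Re frakc3S`,
  `RepairGluedForm.mainTermForm_add_refl`), **`C232S_eq_frakc`** (`= Re 𝔠₁T + Re 𝔠₂T + 2Re frakc3S`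
  with p2's `frakc1T/2T_eq_mainTermForm`: the full dictionary of `C₂₃₂ = 𝔠₁ + 𝔠₂ + 2Re 𝔠₃`),
  `C232S_nonneg` (T-zero impossible);
* boundary data: `h1Profile_zero = a0T`, `h2Profile_zero = b0T`, `h1Profile_one = h2Profile_one = 0`,
  `kappaTail_zero_eq_kappaInt` (bridge between the two closed forms of `∫₀^ν ϰ`: p2's `kappaTail · · 0`
  and `RepairFormulaIIBlock.kappaInt`), `integral_kappaP_unit`, `integral_h1Profile = IaT`,
  `integral_h2Profile = IbT`;
* **`frakc3S_eq`**: `frakc3S θ = F0part θ + WT θ` with **`WT θ := windowForm (h1Profile θ) … (R̃ h2Profile θ) …`**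
  the exact window form of `RepairCrossSlotForm` on the design (integrals over the overlaps
  `[1−ν₂, ν₁] ∪ [1−ν₃, ν₁]` only) — by `mainTermFormPolar_refl_eq` and the boundary data; hence, with
  `F0part_eq` (`F0part = frakc3rT − 2e2starT`): **`discS_eq : frakc3S θ − frakc3rT θ = WT θ − 2·e2starT θ`**
  — the transcribed reduced `𝔠₃` differs from the functional of record exactly by
  (exact window form) − (the manuscript's linearised window evaluation `2e₂*` of (12.13)–(12.17));
  `frakc3S_sub_frakc3DT` (derived-`e″` reading: minus `identResidualᴰ` in addition);
  `C232S_eq_C232D_add : C232S θ = C232D θ + 2 Re discS θ` (functional of record vs p3's transcribed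
  assembly `C232D = C232T θ (frakc1T θ) (frakc2T θ)`). Numerically (cell numerics of record, kit
  j250370 / j250780): `|discS| = 3.3·10⁻⁶` at `θ₀`, `≤ 1.0·10⁻⁴` on the tie segment `ν₁ ∈ [0.5005, 0.510]`;
  the closed form of `WT` and a kernel enclosure at `θ₀` are the follow-on.

Bookkeeping over landed calculus; no `Prop` facts, no statement about Theorems 1–2.
-/

noncomputable section

open Complex Real ComplexConjugate Set MeasureTheory intervalIntegral

namespace Literature.NumberTheory.LFunctions.Zhang2022

namespace Repair

variable {θ : Theta}

/-! ### The objects of record -/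

/-- The GLUED profile of the test vector `𝔥 = H₁ + Z(s,χψ)H̄₂` ((2.27), (2.32)): `𝔤_θ = g₁ + R̃g₂` on `[0,1]`.
[cite: Zhang2022LandauSiegel, §2 (2.27), (2.32); §12 (12.6)–(12.8)] -/
def gluedS (θ : Theta) : ℝ → ℂ := fun y => h1Profile θ y + reflProfile (h2Profile θ) y

/-- Derivative companion of the glued profile. [cite: Zhang2022LandauSiegel, §2 (2.27), (2.32)] -/
def gluedS' (θ : Theta) : ℝ → ℂ := fun y => h1Profile' θ y + reflDeriv (h2Profile' θ) y

/-- **The `𝔠₃` slot of record (K-S2)**: the exact bilinear main term of `Ξ₁₃/(𝔞𝔓)`, the polar value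
`P(g₁, R̃g₂)`. [cite: Zhang2022LandauSiegel, §18 (18.1); §8 (8.2)] -/
def frakc3S (θ : Theta) : ℂ :=
  mainTermFormPolar (h1Profile θ) (h1Profile' θ) (reflProfile (h2Profile θ)) (reflDeriv (h2Profile' θ))

/-- **The §18 margin functional of record**: `C₂₃₂(θ) = 𝔅(𝔤_θ, 𝔤_θ)`. [cite: Zhang2022LandauSiegel, §2 (2.32); §18] -/
def C232S (θ : Theta) : ℝ := mainTermForm (gluedS θ) (gluedS' θ)

/-- The exact WINDOW form of the cross slot on the design (`RepairCrossSlotForm.windowForm`; its integrands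
live on `[1−ν₂, ν₁] ∪ [1−ν₃, ν₁]`). [cite: Zhang2022LandauSiegel, §12 (12.12)–(12.17); §18 (18.1)] -/
def WT (θ : Theta) : ℂ :=
  windowForm (h1Profile θ) (h1Profile' θ) (reflProfile (h2Profile θ)) (reflDeriv (h2Profile' θ))

/-- **The K-S2 discrepancy of record**: functional of record minus the transcribed reduced reading.
[cite: Zhang2022LandauSiegel, §18 (18.1)–(18.2)] -/
def discS (θ : Theta) : ℂ := frakc3S θ - frakc3rT θ

/-- `C232S` is literally the form of the glued profile (the `h232` hypothesis of the verdict statement).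
[cite: Zhang2022LandauSiegel, §2 (2.32)] -/
theorem C232S_eq_form (θ : Theta) : C232S θ = mainTermForm (gluedS θ) (gluedS' θ) := rfl

/-! ### Bounds extracted from the admissible class -/

/-- The inequalities of `AdmissibleTheta` used in this file (plumbing). [folklore] -/
private theorem adm_bounds (h : AdmissibleTheta θ) :
    0 < θ.nu3 ∧ θ.nu3 ≤ θ.nu2 ∧ θ.nu2 ≤ θ.nu1 ∧ θ.nu2 ≤ 1 ∧ θ.nu1 ≤ 1 ∧ θ.nu3 ≤ 1
      ∧ θ.k1 ≠ 0 ∧ θ.k2 ≠ 0 ∧ θ.k3 ≠ 0 := by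
  obtain ⟨⟨h32, h21⟩, -, h1, h13, -, ⟨⟨hk1, -⟩, ⟨hk2, -⟩, ⟨hk3, -⟩⟩, -⟩ := h
  unfold Theta.belowP at h1
  unfold Theta.dualRangesNonempty at h13
  exact ⟨by linarith, h32.le, h21.le, by linarith, h1.le, by linarith, hk1.ne', hk2.ne', hk3.ne'⟩

/-! ### `H¹` witnesses, block expansion, positivity -/

/-- The glued design profile is `H¹` on the admissible class (the `hgl` hypothesis of the verdict statement).
[cite: Zhang2022LandauSiegel, §2 (2.27), (2.32)] -/
theorem gluedS_isH1 (h : AdmissibleTheta θ) : IsH1OnUnitInterval (gluedS θ) (gluedS' θ) :=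
  (kinkedProfile_h1Profile h).isH1.add_refl (kinkedProfile_h2Profile h).isH1

/-- **`C232S θ = 𝔅(g₁) + 𝔅(g₂) + 2 Re frakc3S θ`** on the admissible class. [cite: Zhang2022LandauSiegel, §8 (8.2); §18 (18.1)] -/
theorem C232S_eq_blocks (h : AdmissibleTheta θ) :
    C232S θ = mainTermForm (h1Profile θ) (h1Profile' θ) + mainTermForm (h2Profile θ) (h2Profile' θ)
      + 2 * (frakc3S θ).re :=
  mainTermForm_add_refl (kinkedProfile_h1Profile h).isH1 (kinkedProfile_h2Profile h).isH1

/-- **The dictionary of `C₂₃₂ = 𝔠₁ + 𝔠₂ + 2Re 𝔠₃`**: `C232S θ = Re 𝔠₁T(θ) + Re 𝔠₂T(θ) + 2 Re frakc3S θ`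
(pair blocks by `RepairPairFormGram.frakc1T/frakc2T_eq_mainTermForm`). [cite: Zhang2022LandauSiegel, §8 (8.2), (8.23), (9.7); §18 (18.1)] -/
theorem C232S_eq_frakc (h : AdmissibleTheta θ) :
    C232S θ = (frakc1T θ).re + (frakc2T θ).re + 2 * (frakc3S θ).re := by
  rw [C232S_eq_blocks h, frakc1T_eq_mainTermForm h, frakc2T_eq_mainTermForm h, Complex.ofReal_re,
    Complex.ofReal_re]

/-- **T-zero is impossible for the functional of record**: `0 ≤ C232S θ` on the admissible class.
[cite: Zhang2022LandauSiegel, §2 Lemma 2.3, (2.32)] -/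
theorem C232S_nonneg (h : AdmissibleTheta θ) : 0 ≤ C232S θ :=
  mainTermForm_nonneg_of_isH1 (gluedS_isH1 h)

/-! ### Boundary data of the design -/

/-- `ϰ(ν,k)(0) = e^{iπkν} = vkR ν k` for `0 ≤ ν`. [cite: Zhang2022LandauSiegel, (2.23)–(2.25), (17.4)] -/
theorem kappaP_zero {ν k : ℝ} (hν : 0 ≤ ν) : kappaP ν k 0 = vkR ν k := by
  rw [kappaP_of_le hν]
  unfold vkR
  simp only [zero_div, sub_zero]
  push_cast
  rw [one_mul]
  congr 1
  ring

/-- `g₁(0) = a₀(θ) = e^{iπk₁ν₁} + ι₂e^{iπk₂ν₂}`. [cite: Zhang2022LandauSiegel, (17.4)] -/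
theorem h1Profile_zero (h : AdmissibleTheta θ) : h1Profile θ 0 = a0T θ := by
  obtain ⟨h3, h32, h21, -, -, -, -, -, -⟩ := adm_bounds h
  unfold h1Profile pairProfile a0T vk1T vk2T
  rw [kappaP_zero (by linarith), kappaP_zero (by linarith), one_mul]

/-- `g₂(0) = b₀(θ) = ῑ₃e^{iπk₃ν₃} + ῑ₄e^{iπk₂ν₂}`. [cite: Zhang2022LandauSiegel, (17.4)] -/
theorem h2Profile_zero (h : AdmissibleTheta θ) : h2Profile θ 0 = b0T θ := by
  obtain ⟨h3, h32, -, -, -, -, -, -, -⟩ := adm_bounds h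
  unfold h2Profile pairProfile b0T vk3T vk2T
  rw [kappaP_zero (by linarith), kappaP_zero h3.le]
  ring

/-- `g₁(1) = 0`. [cite: Zhang2022LandauSiegel, (2.23)–(2.24)] -/
theorem h1Profile_one (h : AdmissibleTheta θ) : h1Profile θ 1 = 0 := by
  obtain ⟨h3, h32, h21, h2le, h1le, -, -, -, -⟩ := adm_bounds h
  unfold h1Profile pairProfile
  rw [kappaP_one (by linarith) h1le, kappaP_one (by linarith) h2le]; ring

/-- `g₂(1) = 0`. [cite: Zhang2022LandauSiegel, (2.24)–(2.25)] -/
theorem h2Profile_one (h : AdmissibleTheta θ) : h2Profile θ 1 = 0 := by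
  obtain ⟨h3, h32, h21, h2le, h1le, h3le, -, -, -⟩ := adm_bounds h
  unfold h2Profile pairProfile
  rw [kappaP_one (by linarith) h2le, kappaP_one h3 h3le]; ring

/-- **Bridge between the two closed forms of `∫₀^ν ϰ`**: p2's `kappaTail ν k 0` and `kappaInt ν k`
(`RepairFormulaIIBlock`) — two evaluations of one integral. [cite: Zhang2022LandauSiegel, (2.23)–(2.25), Lemma 15.1] -/
theorem kappaTail_zero_eq_kappaInt {ν k : ℝ} (hk : k ≠ 0) (hν : 0 < ν) (hν1 : ν ≤ 1) :
    kappaTail ν k 0 = kappaInt ν k := by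
  rw [← integral_kappaP_tail hk hν hν1 hν.le, ← integral_kappa_shape hν.ne' hk]
  have hi2 : IntervalIntegrable (kappaP ν k) volume ν 1 := by
    refine IntervalIntegrable.congr ?_ (intervalIntegrable_const (c := (0:ℂ)))
    intro t ht
    rw [uIoc_of_le hν1] at ht
    exact (kappaP_of_ge hν.ne' ht.1.le).symm
  have hc : Continuous fun t : ℝ =>
      (((1 - t / ν : ℝ)) : ℂ) * cexp ((k : ℂ) * π * I * ((ν - t : ℝ) : ℂ)) := by fun_prop
  have hi1 : IntervalIntegrable (kappaP ν k) volume 0 ν := by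
    refine IntervalIntegrable.congr ?_ (hc.intervalIntegrable 0 ν)
    intro t ht
    rw [uIoc_of_le hν.le] at ht
    exact (kappaP_of_le ht.2).symm
  rw [← intervalIntegral.integral_add_adjacent_intervals hi1 hi2,
    integral_kappaP_tail_of_ge hν le_rfl hν1, add_zero]
  refine intervalIntegral.integral_congr fun t ht => ?_
  rw [uIcc_of_le hν.le] at ht
  rw [kappaP_of_le ht.2]
  push_cast
  ring_nf

/-- `∫₀¹ ϰ(ν,k) = kappaInt ν k` (`k ≠ 0`, `0 < ν ≤ 1`). [cite: Zhang2022LandauSiegel, (2.23)–(2.25), Lemma 15.1] -/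
theorem integral_kappaP_unit {ν k : ℝ} (hk : k ≠ 0) (hν : 0 < ν) (hν1 : ν ≤ 1) :
    ∫ t in (0:ℝ)..1, kappaP ν k t = kappaInt ν k := by
  rw [integral_kappaP_tail hk hν hν1 hν.le, kappaTail_zero_eq_kappaInt hk hν hν1]

/-- `ϰ` is interval-integrable on `[0,1]` (plumbing). [folklore] -/
private theorem intervalIntegrable_kappaP_unit {ν k : ℝ} (hν : 0 < ν) (hν1 : ν ≤ 1) :
    IntervalIntegrable (kappaP ν k) volume 0 1 :=
  ((kinkedProfile_kappaP (k := k) hν hν1).cont.mono (by rw [uIcc_of_le zero_le_one])).intervalIntegrable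

/-- `∫₀¹ g₁ = I_a(θ)`. [cite: Zhang2022LandauSiegel, §2 (2.23)–(2.27)] -/
theorem integral_h1Profile (h : AdmissibleTheta θ) : ∫ t in (0:ℝ)..1, h1Profile θ t = IaT θ := by
  obtain ⟨h3, h32, h21, h2le, h1le, -, hk1, hk2, -⟩ := adm_bounds h
  have h1 : 0 < θ.nu1 := by linarith
  have h2 : 0 < θ.nu2 := by linarith
  unfold h1Profile pairProfile IaT
  rw [intervalIntegral.integral_add ((intervalIntegrable_kappaP_unit h1 h1le).const_mul _)
      ((intervalIntegrable_kappaP_unit h2 h2le).const_mul _),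
    intervalIntegral.integral_const_mul, intervalIntegral.integral_const_mul,
    integral_kappaP_unit hk1 h1 h1le, integral_kappaP_unit hk2 h2 h2le, one_mul]

/-- `∫₀¹ g₂ = I_b(θ)`. [cite: Zhang2022LandauSiegel, §2 (2.24)–(2.27)] -/
theorem integral_h2Profile (h : AdmissibleTheta θ) : ∫ t in (0:ℝ)..1, h2Profile θ t = IbT θ := by
  obtain ⟨h3, h32, h21, h2le, h1le, h3le, -, hk2, hk3⟩ := adm_bounds h
  have h2 : 0 < θ.nu2 := by linarith
  unfold h2Profile pairProfile IbT
  rw [intervalIntegral.integral_add ((intervalIntegrable_kappaP_unit h2 h2le).const_mul _)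
      ((intervalIntegrable_kappaP_unit h3 h3le).const_mul _),
    intervalIntegral.integral_const_mul, intervalIntegral.integral_const_mul,
    integral_kappaP_unit hk2 h2 h2le, integral_kappaP_unit hk3 h3 h3le]
  ring

/-! ### The functional of record against the transcribed readings -/

/-- **`frakc3S θ = F0part θ + WT θ`** on the admissible class: the exact bilinear cross term is the
formula-II boundary block (= `−i(3𝔢′₁+3𝔢′₂+𝔢′₃+𝔢₀)`, `RepairFormulaIIBlock.F0part_eq`) plus the exact
window form. [cite: Zhang2022LandauSiegel, §18 (18.1); §12 (12.12)–(12.17)] -/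
theorem frakc3S_eq (h : AdmissibleTheta θ) : frakc3S θ = F0part θ + WT θ := by
  unfold frakc3S WT
  rw [mainTermFormPolar_refl_eq (kinkedProfile_h1Profile h).cont (kinkedProfile_h2Profile h).cont
      (h1Profile_one h) (h2Profile_one h),
    h1Profile_zero h, h2Profile_zero h, integral_h1Profile h, integral_h2Profile h, F0gen_design]

/-- **`discS θ = WT θ − 2·e2starT θ`**: the transcribed reduced `𝔠₃` differs from the functional of record
exactly by (exact window form) − (the manuscript's linearised window evaluation `2e₂*`).
[cite: Zhang2022LandauSiegel, §12 (12.13)–(12.17); §18 (18.1)–(18.2)] -/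
theorem discS_eq (h : AdmissibleTheta θ) : discS θ = WT θ - 2 * e2starT θ := by
  obtain ⟨h3, h32, h21, -, -, -, hk1, hk2, hk3⟩ := adm_bounds h
  unfold discS
  rw [frakc3S_eq h, F0part_eq θ (by linarith) (by linarith) h3.ne' hk1 hk2 hk3]
  ring

/-- The derived-`e″` reading: `frakc3S − frakc3DT = WT − 2e₂* − identResidualᴰ`.
[cite: Zhang2022LandauSiegel, §18 (18.1)–(18.2)] -/
theorem frakc3S_sub_frakc3DT (h : AdmissibleTheta θ) :
    frakc3S θ - frakc3DT θ = WT θ - 2 * e2starT θ - identResidualDT θ := by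
  obtain ⟨h3, h32, h21, -, -, -, hk1, hk2, hk3⟩ := adm_bounds h
  rw [frakc3S_eq h, F0part_eq_D θ (by linarith) (by linarith) h3.ne' hk1 hk2 hk3]
  ring

/-- **Functional of record vs transcribed assembly**: `C232S θ = C232D θ + 2 Re discS θ`
(`C232D = C232T θ (frakc1T θ) (frakc2T θ)`, `RepairFrakc12Theta`). [cite: Zhang2022LandauSiegel, §2 (2.32); §18] -/
theorem C232S_eq_C232D_add (h : AdmissibleTheta θ) : C232S θ = C232D θ + 2 * (discS θ).re := by
  rw [C232S_eq_frakc h]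
  unfold C232D C232T discS
  rw [Complex.sub_re]
  ring

end Repair

end Literature.NumberTheory.LFunctions.Zhang2022
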